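import Literature.MathematicalPhysics.QuantumFieldTheory.Balaban1983to89.B8Eq146AExpansion

/-!
# Bałaban, CMP **102** (1985) 277–309 [B11] — (34)–(36) pp. 283–284: the third-order Baker–Campbell–Hausdorff
expansion of `∂₀U₁((p)_z) = Π_{b⊂(∂p)_z} exp iηA′(b)` and the third-order term `V^{(3)}(A, ∂p)`

Honest framing: statement-level skeleton of published theorems with citation tags; proofs where landed; nothing
here is a claim about the Yang–Mills mass gap.

v1.1 (r08 gen 41, 2026-08-22): DOCFIX ONLY — the p. 282 sentence quoted in the docstring of `Z1_Aprime` restored to the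
verbatim «The expression in parenthesis (…) on the right-hand side is equal to η(DA)(p)» (v1 clipped «on the right-hand
side»; r08 `QUOTE-AUDIT-B11.md` §C item L1; render `…-p006-x2.png` re-read). Declarations byte-identical.

## What is printed (pp. 283–284, renders `…-p007-x2.png`, `…-p008-x2.png`)

«Let us define field variables `A′(b)` for bonds `b ⊂ ∂(p)_z` by the equalities
`A′(z, w) = R(U₀(x, w))A(z, w)`, `A′(w, x) = A(w, x)`, `A′(x, y) = A(x, y)`, `A′(y, z) = R(U₀(x, y))A(y, z)`,
and let `≺` denote a natural ordering among bonds of the oriented contour `∂(p)_z = ⟨z, w⟩ ∪ ⟨w, x⟩ ∪ ⟨x, y⟩ ∪ ⟨y, z⟩`.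
From the Baker–Cambell–Hausdorff formula we have
`∂₀U₁((p)_z) = exp iηR(U₀(x, w))A(z, w) exp iηA(w, x) exp iηA(x, y)·exp iηR(U₀(x, y))A(y, z) = Π_{b⊂(∂p)_z} exp iηA′(b)`
`= exp{iηΣ_b A′(b) + ½i²η² Σ_{b₁≺b₂}[A′(b₁), A′(b₂)]`
`+ (1/12)i³η³ Σ_{b₁≺b₂}([A′(b₁), [A′(b₁), A′(b₂)]] + [[A′(b₁), A′(b₂)], A′(b₂)])`
`+ (1/6)i³η³ Σ_{b₁≺b₂≺b₃}([A′(b₁), [A′(b₂), A′(b₃)]] + [[A′(b₁), A′(b₂)], A′(b₃)]) + …}. (34)`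
If we write expansion (26) in the form
`1 − Re tr ∂₀U₁((p)_z)U₀(∂p) = 1 − Re tr U₀(∂p) + η⁴Σ_{i=1}^{3} V^{(i)}(A, ∂p) + η⁴V₄(A, ∂p), (35)`
then (34) yields
`V^{(3)}(A, ∂p) = ¼tr[(DA)(p) Σ_{b₁≺b₂} i[A′(b₁), A′(b₂)] + Σ_{b₁≺b₂} i[A′(b₁), A′(b₂)](DA)(p)]Re U₀(∂p)`
`+ (1/12)η tr Σ_{b₁≺b₂}(i[A′(b₁), i[A′(b₁), A′(b₂)]] + i[i[A′(b₁), A′(b₂)], A′(b₂)])η⁻² Im U₀(∂p)`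
`+ (1/6)η tr Σ_{b₁≺b₂≺b₃}(i[A′(b₁), i[A′(b₂), A′(b₃)]] + i[i[A′(b₁), A′(b₂)], A′(b₃)])η⁻² Im U₀(∂p)`
`− (1/3!)η⁴ tr((DA)(p))³η⁻² Im U₀(∂p). (36)`»

## What is here (kernel-checked, sorry-free)

* §1 THE FORMAL CONTENT OF (34) THROUGH THE THIRD ORDER, in an arbitrary ring, for four non-commuting variables
  `Y₁ ≺ Y₂ ≺ Y₃ ≺ Y₄` (print: `Yᵢ = iηA′(bᵢ)`): with `Z₁ = ΣYᵢ`, `C = Σ_{i≺j}[Yᵢ, Yⱼ]`,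
  `P = Σ_{i≺j}([Yᵢ, [Yᵢ, Yⱼ]] + [[Yᵢ, Yⱼ], Yⱼ])`, `T = Σ_{i≺j≺k}([Yᵢ, [Yⱼ, Yₖ]] + [[Yᵢ, Yⱼ], Yₖ])` the homogeneous
  components of `Π e^{Yᵢ}` of degrees 2 and 3 are those of `exp{Z₁ + ½C + (1/12)P + (1/6)T}`:
  `ΣYᵢ² + 2Σ_{i≺j}YᵢYⱼ = Z₁² + C` (`bch4_degree2`) and
  `2ΣYᵢ³ + 6Σ_{i≺j}(Yᵢ²Yⱼ + YᵢYⱼ²) + 12Σ_{i≺j≺k}YᵢYⱼYₖ = 2Z₁³ + 3(Z₁C + CZ₁) + P + 2T` (`bch4_degree3`) — the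
  coefficient identities (denominators cleared) that make (34) correct to the third order; PROVED by `noncomm_ring`.
* §2 the dictionary to the tree: print's `A′(⟨z,w⟩), A′(⟨w,x⟩), A′(⟨x,y⟩), A′(⟨y,z⟩)` are the variables
  `X₃, X₄, X₁, X₂` of `B8Eq146AExpansion` ((1.49) of [6], with `A(z, w) = −A(w, z)`); `Σ_b A′(b)` is its `lin`
  (`= η(D^η_{U₀}A)(p)`, `B8Eq146AExpansion.lin_eq_smul_plaqCovDeriv`), and the bracket of (25) is `Z₁² + C`
  (`bracket25_eq`).
* §3 **(36)** `V^{(3)}` as a DEFINITION, verbatim, over an abstract trace `τ` and the two elements `Re U₀(∂p)`,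
  `η⁻² Im U₀(∂p)` supplied as data (`V3`), with its unfolding lemma.

## HONEST SCOPE — what is NOT claimed

The ANALYTIC statement behind «+ …» in (34) (convergence of the BCH series, or a fourth-order remainder bound for
`log Π e^{Yᵢ}`) is NOT proved here — only the exact polynomial identities in degrees ≤ 3; the derivation (34), (35) ⇒
(36) (which uses `Re tr`, hermiticity of `A′`, `(DA)(p)` and drops the purely imaginary traces) and the bound (37)
are NOT typed (the arithmetic chain of (37) is `B11Smallness.ineq37`).  Nothing here is progress on the summit
`Summit.QuantumFields`.
-/

namespace Literature.MathematicalPhysics.QuantumFieldTheory.Balaban1983to89.B11Eq34BCH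

/-! ## §1 (34) through the third order: the coefficient identities in a ring -/

section Formal

variable {R : Type*} [Ring R]

/-- `Z₁ = Σ_b Y(b)` — the first-order BCH term of (34) (print: `iηΣ_b A′(b)`).
[cite: Balaban1985Variational, (34) p.283] -/
def Z1 (Y₁ Y₂ Y₃ Y₄ : R) : R := Y₁ + Y₂ + Y₃ + Y₄

/-- `C = Σ_{b₁≺b₂}[Y(b₁), Y(b₂)]` — twice the second-order BCH term of (34) (print: `½i²η²Σ_{b₁≺b₂}[A′(b₁), A′(b₂)]`).
[cite: Balaban1985Variational, (34) p.283] -/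
def comm2 (Y₁ Y₂ Y₃ Y₄ : R) : R :=
  ⁅Y₁, Y₂⁆ + ⁅Y₁, Y₃⁆ + ⁅Y₁, Y₄⁆ + ⁅Y₂, Y₃⁆ + ⁅Y₂, Y₄⁆ + ⁅Y₃, Y₄⁆

/-- `P = Σ_{b₁≺b₂}([Y(b₁), [Y(b₁), Y(b₂)]] + [[Y(b₁), Y(b₂)], Y(b₂)])` — `12 ×` the pair part of the third-order BCH
term of (34). [cite: Balaban1985Variational, (34) p.283] -/
def comm3pair (Y₁ Y₂ Y₃ Y₄ : R) : R :=
  (⁅Y₁, ⁅Y₁, Y₂⁆⁆ + ⁅⁅Y₁, Y₂⁆, Y₂⁆) + (⁅Y₁, ⁅Y₁, Y₃⁆⁆ + ⁅⁅Y₁, Y₃⁆, Y₃⁆) + (⁅Y₁, ⁅Y₁, Y₄⁆⁆ + ⁅⁅Y₁, Y₄⁆, Y₄⁆)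
    + (⁅Y₂, ⁅Y₂, Y₃⁆⁆ + ⁅⁅Y₂, Y₃⁆, Y₃⁆) + (⁅Y₂, ⁅Y₂, Y₄⁆⁆ + ⁅⁅Y₂, Y₄⁆, Y₄⁆) + (⁅Y₃, ⁅Y₃, Y₄⁆⁆ + ⁅⁅Y₃, Y₄⁆, Y₄⁆)

/-- `T = Σ_{b₁≺b₂≺b₃}([Y(b₁), [Y(b₂), Y(b₃)]] + [[Y(b₁), Y(b₂)], Y(b₃)])` — `6 ×` the triple part of the third-order
BCH term of (34). [cite: Balaban1985Variational, (34) p.283] -/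
def comm3triple (Y₁ Y₂ Y₃ Y₄ : R) : R :=
  (⁅Y₁, ⁅Y₂, Y₃⁆⁆ + ⁅⁅Y₁, Y₂⁆, Y₃⁆) + (⁅Y₁, ⁅Y₂, Y₄⁆⁆ + ⁅⁅Y₁, Y₂⁆, Y₄⁆) + (⁅Y₁, ⁅Y₃, Y₄⁆⁆ + ⁅⁅Y₁, Y₃⁆, Y₄⁆)
    + (⁅Y₂, ⁅Y₃, Y₄⁆⁆ + ⁅⁅Y₂, Y₃⁆, Y₄⁆)

/-- `2 ×` the degree-2 component of `e^{Y₁}e^{Y₂}e^{Y₃}e^{Y₄}`: `ΣYᵢ² + 2Σ_{i≺j}YᵢYⱼ` (the bracket of (25)).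
[cite: Balaban1985Variational, (25) p.282, (34) p.283] -/
def prod2 (Y₁ Y₂ Y₃ Y₄ : R) : R :=
  Y₁ * Y₁ + Y₂ * Y₂ + Y₃ * Y₃ + Y₄ * Y₄
    + 2 * (Y₁ * Y₂ + Y₁ * Y₃ + Y₁ * Y₄ + Y₂ * Y₃ + Y₂ * Y₄ + Y₃ * Y₄)

/-- `12 ×` the degree-3 component of `e^{Y₁}e^{Y₂}e^{Y₃}e^{Y₄}`:
`2ΣYᵢ³ + 6Σ_{i≺j}(Yᵢ²Yⱼ + YᵢYⱼ²) + 12Σ_{i≺j≺k}YᵢYⱼYₖ`. [cite: Balaban1985Variational, (34) p.283] -/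
def prod3 (Y₁ Y₂ Y₃ Y₄ : R) : R :=
  2 * (Y₁ * Y₁ * Y₁ + Y₂ * Y₂ * Y₂ + Y₃ * Y₃ * Y₃ + Y₄ * Y₄ * Y₄)
    + 6 * ((Y₁ * Y₁ * Y₂ + Y₁ * Y₂ * Y₂) + (Y₁ * Y₁ * Y₃ + Y₁ * Y₃ * Y₃) + (Y₁ * Y₁ * Y₄ + Y₁ * Y₄ * Y₄)
      + (Y₂ * Y₂ * Y₃ + Y₂ * Y₃ * Y₃) + (Y₂ * Y₂ * Y₄ + Y₂ * Y₄ * Y₄) + (Y₃ * Y₃ * Y₄ + Y₃ * Y₄ * Y₄))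
    + 12 * (Y₁ * Y₂ * Y₃ + Y₁ * Y₂ * Y₄ + Y₁ * Y₃ * Y₄ + Y₂ * Y₃ * Y₄)

/-- **(34), second order**: the degree-2 component of `Πe^{Yᵢ}` is that of `exp{Z₁ + ½C + …}`, i.e.
`ΣYᵢ² + 2Σ_{i≺j}YᵢYⱼ = Z₁² + C` (`½Z₁² + ½C` on both sides, doubled). [cite: Balaban1985Variational, (34) p.283] -/
theorem bch4_degree2 (Y₁ Y₂ Y₃ Y₄ : R) :
    prod2 Y₁ Y₂ Y₃ Y₄ = Z1 Y₁ Y₂ Y₃ Y₄ * Z1 Y₁ Y₂ Y₃ Y₄ + comm2 Y₁ Y₂ Y₃ Y₄ := by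
  simp only [prod2, Z1, comm2, Ring.lie_def]
  noncomm_ring

/-- **(34), third order**: the degree-3 component of `Πe^{Yᵢ}` is that of
`exp{Z₁ + ½C + (1/12)P + (1/6)T}`, namely `(1/12)P + (1/6)T + ½(Z₁·½C + ½C·Z₁) + (1/6)Z₁³`; with denominators
cleared (`× 12`): `prod3 = 2Z₁³ + 3(Z₁C + CZ₁) + P + 2T`. [cite: Balaban1985Variational, (34) p.283] -/
theorem bch4_degree3 (Y₁ Y₂ Y₃ Y₄ : R) :
    prod3 Y₁ Y₂ Y₃ Y₄ =
      2 * (Z1 Y₁ Y₂ Y₃ Y₄ * Z1 Y₁ Y₂ Y₃ Y₄ * Z1 Y₁ Y₂ Y₃ Y₄)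
        + 3 * (Z1 Y₁ Y₂ Y₃ Y₄ * comm2 Y₁ Y₂ Y₃ Y₄ + comm2 Y₁ Y₂ Y₃ Y₄ * Z1 Y₁ Y₂ Y₃ Y₄)
        + comm3pair Y₁ Y₂ Y₃ Y₄ + 2 * comm3triple Y₁ Y₂ Y₃ Y₄ := by
  simp only [prod3, Z1, comm2, comm3pair, comm3triple, Ring.lie_def]
  noncomm_ring

/-- The same identities for TWO factors (`Y₃ = Y₄ = 0`): the classical
`log(e^{X}e^{Y}) = X + Y + ½[X, Y] + (1/12)([X, [X, Y]] + [[X, Y], Y]) + …` through degree 3, denominators cleared.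
[cite: Balaban1985Variational, (34) p.283] -/
theorem bch2_degree3 (X Y : R) :
    2 * (X * X * X + Y * Y * Y) + 6 * (X * X * Y + X * Y * Y) =
      2 * ((X + Y) * (X + Y) * (X + Y)) + 3 * ((X + Y) * ⁅X, Y⁆ + ⁅X, Y⁆ * (X + Y))
        + (⁅X, ⁅X, Y⁆⁆ + ⁅⁅X, Y⁆, Y⁆) := by
  simp only [Ring.lie_def]
  noncomm_ring

end Formal

/-! ## §2 The dictionary: print's `A′(b)`, `b ⊂ (∂p)_z`, are the variables `X₃ ≺ X₄ ≺ X₁ ≺ X₂` of (1.49) [6] -/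

section Dictionary

open B7Prop1Explicit
open B8Eq146AExpansion (X1 X2 X3 X4 lin)

-- `Site` alone would resolve to the torus sites of `Setup.lean`; re-export the `ℤ^d` sites of `B7Prop1Explicit`.
export B7Prop1Explicit (Site)

variable {d : ℕ} {𝔸 : Type*} [NormedRing 𝔸]

/-- «`A′(z, w) = R(U₀(x, w))A(z, w)`, `A′(w, x) = A(w, x)`, `A′(x, y) = A(x, y)`, `A′(y, z) = R(U₀(x, y))A(y, z)`» in the
order `≺` of `∂(p)_z = ⟨z,w⟩ ∪ ⟨w,x⟩ ∪ ⟨x,y⟩ ∪ ⟨y,z⟩`: the 4-tuple `(X₃, X₄, X₁, X₂)` of `B8Eq146AExpansion`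
(`A(z, w) = −A(w, z)`, (3.5) of [5]). [cite: Balaban1985Variational, p.283 (before (34))] -/
def Aprime (U₀ : Site d → Fin d → 𝔸ˣ) (A : Site d → Fin d → 𝔸) (μ ν : Fin d) (x : Site d) : Fin 4 → 𝔸 :=
  ![X3 U₀ A μ ν x, X4 A ν x, X1 A μ x, X2 U₀ A μ ν x]

/-- `Σ_{b⊂(∂p)_z} A′(b) = X₁ + X₂ + X₃ + X₄ = lin` (`= η(D^η_{U₀}A)(p)` by `B8Eq146AExpansion.lin_eq_smul_plaqCovDeriv`:
«The expression in parenthesis (…) on the right-hand side is equal to η(DA)(p)», p. 282). [cite: Balaban1985Variational, (25) p.282, (34) p.283] -/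
theorem Z1_Aprime (U₀ : Site d → Fin d → 𝔸ˣ) (A : Site d → Fin d → 𝔸) (μ ν : Fin d) (x : Site d) :
    Z1 (Aprime U₀ A μ ν x 0) (Aprime U₀ A μ ν x 1) (Aprime U₀ A μ ν x 2) (Aprime U₀ A μ ν x 3)
      = lin U₀ A μ ν x := by
  simp only [Z1, Aprime, lin, Matrix.cons_val_zero, Matrix.cons_val_one, Matrix.cons_val]
  abel

/-- The bracket of (25) (`= V₂(U₀, A, ∂p)` of (1.49) [6] with the pairs ordered along `(p)_z`) is
`(Σ_b A′(b))² + Σ_{b₁≺b₂}[A′(b₁), A′(b₂)]` — the second-order content of (34). [cite: Balaban1985Variational, (25) p.282, (34) p.283] -/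
theorem bracket25_eq (U₀ : Site d → Fin d → 𝔸ˣ) (A : Site d → Fin d → 𝔸) (μ ν : Fin d) (x : Site d) :
    prod2 (X3 U₀ A μ ν x) (X4 A ν x) (X1 A μ x) (X2 U₀ A μ ν x)
      = lin U₀ A μ ν x * lin U₀ A μ ν x + comm2 (X3 U₀ A μ ν x) (X4 A ν x) (X1 A μ x) (X2 U₀ A μ ν x) := by
  have h : X3 U₀ A μ ν x + X4 A ν x + X1 A μ x + X2 U₀ A μ ν x = lin U₀ A μ ν x := by
    simp only [lin]
    abel
  rw [bch4_degree2, Z1, h]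

end Dictionary

/-! ## §3 (36): the third-order term `V^{(3)}(A, ∂p)` as printed -/

section V3

variable {𝔸 : Type*} [Ring 𝔸] [Algebra ℂ 𝔸]

/-- **(36)** VERBATIM, as a function of: a trace functional `τ` (print: `tr`), the plaquette derivative `D = (DA)(p)`,
the four variables `Y₁ ≺ Y₂ ≺ Y₃ ≺ Y₄` (`= A′(b)`, `b ⊂ (∂p)_z`), `ReU = Re U₀(∂p)`, `ImU2 = η⁻² Im U₀(∂p)` and `η`:
`V^{(3)} = ¼τ([D·Σ_{i≺j}i[Yᵢ,Yⱼ] + Σ_{i≺j}i[Yᵢ,Yⱼ]·D]·ReU) + (1/12)η·τ(Σ_{i≺j}(i[Yᵢ, i[Yᵢ,Yⱼ]] + i[i[Yᵢ,Yⱼ],Yⱼ])·ImU2)`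
`+ (1/6)η·τ(Σ_{i≺j≺k}(i[Yᵢ, i[Yⱼ,Yₖ]] + i[i[Yᵢ,Yⱼ],Yₖ])·ImU2) − (1/3!)η⁴·τ(D³·ImU2)`
(`i[X, i[Y, Z]] = i²[X, [Y, Z]] = −[X, [Y, Z]]`, kept as printed via `Complex.I • ·`).
[cite: Balaban1985Variational, (36) pp.283–284] -/
noncomputable def V3 (τ : 𝔸 →ₗ[ℂ] ℂ) (D Y₁ Y₂ Y₃ Y₄ ReU ImU2 : 𝔸) (η : ℝ) : ℂ :=
  (4 : ℂ)⁻¹ * τ ((D * (Complex.I • comm2 Y₁ Y₂ Y₃ Y₄) + (Complex.I • comm2 Y₁ Y₂ Y₃ Y₄) * D) * ReU)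
    + (12 : ℂ)⁻¹ * η * τ ((Complex.I • (Complex.I • comm3pair Y₁ Y₂ Y₃ Y₄)) * ImU2)
    + (6 : ℂ)⁻¹ * η * τ ((Complex.I • (Complex.I • comm3triple Y₁ Y₂ Y₃ Y₄)) * ImU2)
    - (6 : ℂ)⁻¹ * η ^ 4 * τ (D * D * D * ImU2)

/-- `i·(i·X) = −X`: the double factors `i[·, i[·,·]]` of (36) are minus the plain double commutators.
[cite: Balaban1985Variational, (36) pp.283–284] -/
theorem I_smul_I_smul (X : 𝔸) : Complex.I • (Complex.I • X) = -X := by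
  rw [smul_smul, Complex.I_mul_I, neg_smul, one_smul]

/-- (36) with the `i²` evaluated: the two middle traces enter with a minus sign.
[cite: Balaban1985Variational, (36) pp.283–284] -/
theorem V3_eq (τ : 𝔸 →ₗ[ℂ] ℂ) (D Y₁ Y₂ Y₃ Y₄ ReU ImU2 : 𝔸) (η : ℝ) :
    V3 τ D Y₁ Y₂ Y₃ Y₄ ReU ImU2 η =
      (4 : ℂ)⁻¹ * Complex.I * τ ((D * comm2 Y₁ Y₂ Y₃ Y₄ + comm2 Y₁ Y₂ Y₃ Y₄ * D) * ReU)
        - (12 : ℂ)⁻¹ * η * τ (comm3pair Y₁ Y₂ Y₃ Y₄ * ImU2)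
        - (6 : ℂ)⁻¹ * η * τ (comm3triple Y₁ Y₂ Y₃ Y₄ * ImU2)
        - (6 : ℂ)⁻¹ * η ^ 4 * τ (D * D * D * ImU2) := by
  simp only [V3, I_smul_I_smul, neg_mul, map_neg, mul_neg, smul_mul_assoc, mul_smul_comm, ← smul_add,
    map_smul, smul_eq_mul]
  ring

end V3

end Literature.MathematicalPhysics.QuantumFieldTheory.Balaban1983to89.B11Eq34BCH
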